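import Summits.QuantumFields.YangMills.Theorems.LuscherReductionDressedRitzPolyakovLiftUniversality
import Summits.QuantumFields.YangMills.Theorems.LuscherReductionDressedRitzPolyakovLiftStaticsDressed
import Mathlib.Analysis.Normed.Algebra.QuaternionExponential
import Literature.MathematicalPhysics.QuantumLattice.SU2Haar
import HarnessLib

/-!
# Line «polyakovlift» on crux `DressedRitz` (stmt-QuantumFields-20205): the one-site SHADOW family is never null —
# every element of `SU(2)` has an `L`-th root, so `powLink L` is onto and clause (o0′) of `PScalingDressedAt` holds for every lift basis

Fleet-service module of seat ym-infvol-p1 g5 (route `LuscherReduction`, femto rung R2b1).  The lead's typed split of S-POS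
(`…PolyakovLiftUniversality.lean`: `UniversalityAt k` ∧ `PScalingDressedAt k ⟹ LiftPositionR3`) reads the dressed lift against its ONE-SITE SHADOW
`shadowVec B L e₀ g = K_B^[dressSteps L] (OpPlat.ins e₀ (g ∘ powLink L))`, `powLink L V e = (V e)^L`; the first conjunct of `PScalingDressedAt k` is the
positivity (o0′) `0 < ‖shadowFamily B L e₀ g i‖²`.  This file proves (o0′) for EVERY lift basis, every one-site raw vacuum `e₀`, every `B > 0` and
`L ≥ 1` — the one-site twin of this seat's `liftFamily_o0` ∕ `liftBasis_dressed_o0`: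

* §1 `quaternion_exists_exp_eq_of_norm_eq_one` — every unit quaternion is `exp` of a pure imaginary one (axis–angle); ★ `exists_pow_eq_su2` — every
  `U ∈ SU(2)` has an `L`-th root (`L ≥ 1`): `exp(w/L)^L = exp w`, read in `SU(2)` through the tree's quaternion dictionary
  (`Literature/…/SU2Haar.lean`: `quatMatrix`, `su2Quat`, `quatToSU2`);
* §2 `powLink_surjective`, `continuous_powLink`, `isPhys_comp_powLink` (conjugation and central multiplication commute with powers);
* §3 ★ `shadowFamily_o0` — `∀ i, 0 < l2 (shadowFamily B L e₀ g i) (shadowFamily B L e₀ g i)`: `e₀` vanishes nowhere (`rawVacuum_ne_zero` at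
  `L = 1`), `g_i ∘ powLink L` is continuous and not constant (`eigenRatio_not_const` + §2), so the insertion vector is not null
  (`l2_self_pos_of_continuous`), and `K_B` is injective (`l2_iterate_transferApply_self_pos`).

HONEST FRAMING: fixed-lattice ∕ one-site functional analysis on the CONDITIONAL femto rung R2b1; clause (o0′) only — the one-site semiclassics
(o5′)(o6′) of `PScalingDressedAt` and every RG estimate are untouched; nothing here bears on infinite volume, the continuum limit or the Clay gap.
References: M. Lüscher, NPB 219 (1983) 233, §3 [cite: Luscher1983, §3]; T. Bröcker, T. tom Dieck, Representations of Compact Lie Groups (1985),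
I (1.10) and IV (2.2) (maximal tori, surjectivity of `exp`) [cite: BrockerTomDieck1985, IV (2.2)].
-/

set_option autoImplicit false

noncomputable section

open MeasureTheory Filter Topology
open Literature.MathematicalPhysics.QuantumFieldTheory
open Literature.MathematicalPhysics.QuantumLattice
open scoped BigOperators Quaternion

/-! ## §1 Roots in `SU(2)` via unit quaternions -/


namespace Summit.QuantumFields.YangMills.Theorems.FemtoTransferGap.PolyakovLift

open Summit.QuantumFields.YangMills.Theorems.FemtoTransferGap

section QuatRoots

open Quaternion

/-- **Every unit quaternion is the exponential of a pure imaginary quaternion** (axis–angle form: `q = cos θ + sin θ·u`, `θ = arccos(re q)`,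
`u = im q/‖im q‖`; the poles `q = ±1` separately). [cite: BrockerTomDieck1985, IV (2.2)] -/
theorem quaternion_exists_exp_eq_of_norm_eq_one (q : ℍ) (hq : ‖q‖ = 1) : ∃ w : ℍ, w.re = 0 ∧ NormedSpace.exp w = q := by
  -- `‖q‖² = re² + ‖im q‖²` (also the tree's `T4TreeGaugeNoPrescriptionSU2.norm_sq_eq_re_sq_add_norm_im_sq`; inlined to keep imports light)
  have hnorm : ‖q‖ ^ 2 = q.re ^ 2 + ‖q.im‖ ^ 2 := by
    rw [sq, sq ‖q.im‖, ← normSq_eq_norm_mul_self, ← normSq_eq_norm_mul_self, normSq_def', normSq_def']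
    simp only [re_im, imI_im, imJ_im, imK_im]
    ring
  have hsq : q.re ^ 2 + ‖q.im‖ ^ 2 = 1 := by rw [← hnorm, hq, one_pow]
  by_cases hv : q.im = 0
  · -- real unit quaternion: `q = ±1`
    have hre : q.re ^ 2 = 1 := by rw [hv, norm_zero] at hsq; linarith
    have hq' : q = (q.re : ℍ) := by rw [← re_add_im q, hv, add_zero]; simp
    have hprod : (q.re - 1) * (q.re + 1) = 0 := by nlinarith [hre]
    rcases mul_eq_zero.mp hprod with h1 | h1
    · have h1 : q.re = 1 := by linarith
      refine ⟨0, rfl, ?_⟩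
      rw [NormedSpace.exp_zero, hq', h1]; simp
    · have h1 : q.re = -1 := by linarith
      -- `q = -1 = exp(π·i)`
      set u : ℍ := ⟨0, Real.pi, 0, 0⟩ with hu
      have hure : u.re = 0 := rfl
      have hun : ‖u‖ = Real.pi := by
        have h2 : ‖u‖ ^ 2 = Real.pi ^ 2 := by
          rw [sq, ← normSq_eq_norm_mul_self, normSq_def']
          simp [hu]
        nlinarith [norm_nonneg u, Real.pi_pos, sq_nonneg (‖u‖ - Real.pi), sq_nonneg (‖u‖ + Real.pi)]
      refine ⟨u, hure, ?_⟩
      rw [exp_of_re_eq_zero u hure, hun, Real.cos_pi, Real.sin_pi, zero_div, zero_smul, add_zero, hq', h1]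
  · -- generic: `θ = arccos (re q) ∈ (0, π]`, `w = (θ/‖im q‖) • im q`
    have hvn : 0 < ‖q.im‖ := norm_pos_iff.mpr hv
    set θ : ℝ := Real.arccos q.re with hθ
    have hre1 : q.re ≤ 1 := by nlinarith [sq_nonneg ‖q.im‖]
    have hre2 : -1 ≤ q.re := by nlinarith [sq_nonneg ‖q.im‖]
    have hcos : Real.cos θ = q.re := Real.cos_arccos hre2 hre1
    have hsin : Real.sin θ = ‖q.im‖ := by
      rw [hθ, Real.sin_arccos]
      have : 1 - q.re ^ 2 = ‖q.im‖ ^ 2 := by linarith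
      rw [this, Real.sqrt_sq hvn.le]
    have hθpos : 0 < θ := by
      rw [hθ, Real.arccos_pos]
      by_contra h
      push Not at h
      have : q.re = 1 := le_antisymm hre1 h
      have : ‖q.im‖ ^ 2 = 0 := by rw [this] at hsq; linarith
      exact hv (norm_eq_zero.mp (pow_eq_zero_iff two_ne_zero |>.mp this))
    set w : ℍ := (θ / ‖q.im‖) • q.im with hw
    have hwre : w.re = 0 := by rw [hw, re_smul, re_im, smul_zero]
    have hwn : ‖w‖ = θ := by
      rw [hw, norm_smul, Real.norm_eq_abs, abs_of_pos (div_pos hθpos hvn), div_mul_cancel₀ _ hvn.ne']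
    refine ⟨w, hwre, ?_⟩
    rw [exp_of_re_eq_zero w hwre, hwn, hcos, hsin, hw, smul_smul, div_mul_div_cancel₀ hθpos.ne', div_self hvn.ne', one_smul,
      re_add_im]


end QuatRoots

section Roots

/-- `quatMatrix` is multiplicative on powers. [folklore] -/
theorem quatMatrix_pow (q : ℍ) : ∀ n : ℕ, quatMatrix (q ^ n) = quatMatrix q ^ n
  | 0 => by rw [pow_zero, pow_zero, quatMatrix_one]
  | n + 1 => by rw [pow_succ, pow_succ, quatMatrix_mul, quatMatrix_pow q n]

/-- ★ **Every element of `SU(2)` has an `L`-th root** (`L ≥ 1`): with `su2Quat U = exp w`, `w` pure imaginary, the unit quaternion `exp (w/L)`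
maps to `R ∈ SU(2)` with `R^L = U`. [cite: BrockerTomDieck1985, IV (2.2)] -/
theorem exists_pow_eq_su2 {L : ℕ} (hL : 0 < L) (U : SU2) : ∃ R : SU2, R ^ L = U := by
  obtain ⟨w, hwre, hexp⟩ := quaternion_exists_exp_eq_of_norm_eq_one (su2Quat U) (norm_su2Quat U)
  letI : NormedAlgebra ℚ ℍ := NormedAlgebra.restrictScalars ℚ ℝ ℍ
  set r : ℍ := NormedSpace.exp ((1 / (L : ℝ)) • w) with hr
  have hrL : r ^ L = su2Quat U := by
    rw [hr, ← NormedSpace.exp_nsmul, ← Nat.cast_smul_eq_nsmul ℝ, smul_smul,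
      mul_one_div_cancel (Nat.cast_ne_zero.mpr hL.ne'), one_smul, hexp]
  have hrn : ‖r‖ = 1 := by
    rw [hr, Quaternion.norm_exp]
    have : ((1 / (L : ℝ)) • w).re = 0 := by rw [Quaternion.re_smul, hwre, smul_zero]
    rw [this]
    simp
  refine ⟨quatToSU2 r, Subtype.ext ?_⟩
  rw [SubmonoidClass.coe_pow, coe_quatToSU2_of_norm_eq_one hrn, ← quatMatrix_pow, hrL, quatMatrix_su2Quat]

end Roots

/-! ## §2 The componentwise power map of the one-site model -/

section PowLink

/-- `powLink L` is onto for `L ≥ 1` (roots componentwise). [folklore] -/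
theorem powLink_surjective {L : ℕ} (hL : 0 < L) : Function.Surjective (powLink L) := by
  intro W
  choose R hR using fun e : Edge 3 1 => exists_pow_eq_su2 hL (W e)
  exact ⟨R, funext fun e => hR e⟩

/-- `powLink L` is continuous. [folklore] -/
theorem continuous_powLink (L : ℕ) : Continuous (powLink L) :=
  continuous_pi fun e => (continuous_apply e).pow L

/-- Powers commute with one-site gauge transformations (conjugation). [folklore] -/
theorem powLink_gaugeTransform (L : ℕ) (h : Site 3 1 → SU2) (V : GaugeConfig 3 1 SU2) :
    powLink L (gaugeTransform h V) = gaugeTransform h (powLink L V) := by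
  funext e
  have hs : e.1.shift e.2 = e.1 := Subsingleton.elim _ _
  simp only [powLink, gaugeTransform, hs]
  rw [← conj_pow]

/-- Powers turn the centre twist by `z` into the centre twist by `z^L`. [folklore] -/
theorem powLink_twist (L : ℕ) (k : Fin 3) {z : SU2} (hz : z ∈ Subgroup.center SU2) (V : GaugeConfig 3 1 SU2) :
    powLink L (twist k z V) = twist k (z ^ L) (powLink L V) := by
  funext e
  simp only [powLink, twist]
  split_ifs with h
  · have hc : Commute z (V e) := ((Subgroup.mem_center_iff.mp hz) (V e)).symm
    exact hc.mul_pow L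
  · rfl

/-- `g ∘ powLink L` is a physical one-site function when `g` is. [folklore] -/
theorem isPhys_comp_powLink (L : ℕ) {g : GaugeConfig 3 1 SU2 → ℝ} (hg : IsPhys g) : IsPhys (g ∘ powLink L) := by
  haveI : SecondCountableTopology SU2 := secondCountableTopology_su2
  obtain ⟨C, hC⟩ := hg.bounded
  refine ⟨hg.measurable.comp (continuous_powLink L).measurable, ⟨C, fun V => hC _⟩, fun h V => ?_, fun k z hz V => ?_⟩
  · show g (powLink L (gaugeTransform h V)) = g (powLink L V)
    rw [powLink_gaugeTransform, hg.gaugeInv]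
  · show g (powLink L (twist k z V)) = g (powLink L V)
    rw [powLink_twist L k hz, hg.zeroFlux k (z ^ L) (Subgroup.pow_mem _ hz L)]

end PowLink

/-! ## §3 ★ Clause (o0′): the shadow family is never null -/

section Shadow

/-- ★ **(o0′) for the one-site shadow, EVERY lift basis**: for `B > 0`, a one-site raw vacuum `e₀` at `B` (`IsRawVacuum (L := 1) B e₀`), a lift basis
`(ω, g)` at any `B' > 0` and `L ≥ 1`, every shadow vector `shadowFamily B L e₀ g i = K_B^[dressSteps L] (ins e₀ (g_i ∘ powLink L))` has positive norm.
[cite: Luscher1983, §3] [cite: BrockerTomDieck1985, IV (2.2)] -/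
theorem shadowFamily_o0 {B B' : ℝ} (hB : 0 < B) (hB' : 0 < B') {L : ℕ} (hL : 0 < L) {e₀ : GaugeConfig 3 1 SU2 → ℝ}
    (hvac : IsRawVacuum (L := 1) B e₀) {k : ℕ} {ω : GaugeConfig 3 1 SU2 → ℝ} {g : Fin k → (GaugeConfig 3 1 SU2 → ℝ)}
    (hbasis : LiftBasis B' k ω g) :
    ∀ i : Fin k, 0 < l2 (shadowFamily B L e₀ g i) (shadowFamily B L e₀ g i) := by
  obtain ⟨he₀, he₀1, heig⟩ := hvac
  obtain ⟨hω, hωpos, -, hKω, hg, ⟨σ, hσ⟩, hon⟩ := hbasis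
  intro i
  have hn : l2 (g i * ω) (g i * ω) = 1 := by rw [hon i i, if_pos rfl]
  -- the undressed shadow insertion is continuous, physical and not identically zero
  set O : GaugeConfig 3 1 SU2 → ℝ := g i ∘ powLink L with hOdef
  have hO : IsPhys O := isPhys_comp_powLink L (hg i)
  have hu : IsPhys (OpPlat.ins e₀ O) := OpPlat.isPhys_ins he₀ hO
  have hμ₀ : levelValue su2Rep 1 B' 0 ≠ 0 := by rw [levelValue_zero]; exact (topValue_su2Rep_pos 1 B').ne'
  have hμ : levelValue su2Rep 1 B' ((σ i : ℕ) + 1) ≠ 0 := (levelValue_su2Rep_pos hB' _).ne'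
  have hcontg : Continuous (g i) := continuous_eigenRatio B' hω hωpos hμ₀ hKω (hg i) hμ (hσ i)
  have hconte₀ : Continuous e₀ := by
    refine continuous_of_eigen B he₀ ?_ heig
    rw [levelValue_zero]; exact (topValue_su2Rep_pos 1 B).ne'
  have hcontO : Continuous O := hcontg.comp (continuous_powLink L)
  have hcontu : Continuous (OpPlat.ins e₀ O) := continuous_ins hconte₀ hcontO
  set m : ℝ := l2 e₀ (O * e₀) with hm
  obtain ⟨W, hW⟩ := eigenRatio_not_const (M := 1) hB' hωpos hKω (hσ i) hn m
  obtain ⟨V₀, hV₀⟩ := powLink_surjective hL W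
  have hne : OpPlat.ins e₀ O V₀ ≠ 0 := by
    have hval : OpPlat.ins e₀ O V₀ = (O V₀ - m) * e₀ V₀ := rfl
    have hOV : O V₀ = g i W := by rw [hOdef, Function.comp_apply, hV₀]
    rw [hval, hOV]
    exact mul_ne_zero (sub_ne_zero.mpr hW) (rawVacuum_ne_zero B he₀ he₀1 heig V₀)
  have hpos : 0 < l2 (OpPlat.ins e₀ O) (OpPlat.ins e₀ O) := l2_self_pos_of_continuous hu hcontu hne
  exact l2_iterate_transferApply_self_pos hB hu hpos _

end Shadow

end Summit.QuantumFields.YangMills.Theorems.FemtoTransferGap.PolyakovLift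

end
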